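import Mathlib
import Literature.Analysis.FluidPDE.SpaceTimeRescaling
import Summits.NavierStokesRegularity.NavierStokesRegularity.Theorems.LandauTailLandauTailBlowupDefectFloor

/-!
# Crux `LandauTail.LandauTailBlowup` (stmt-NavierStokesRegularity-1944), line `registered`, cycle c6:
  stub `landauTail_defect_floor_physical` — the `L²`-defect floor in physical variables

Helper file on the proof path of the crux item `stmt-NavierStokesRegularity-1944`
(`Summit.NavierStokesRegularity.NavierStokesRegularity.Theses.LandauTail.LandauTailBlowup`), lead c6: the
registered support stub `landauTail_defect_floor_physical` (A8). With `c = c(U) > 0` as in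
`landauTail_defect_floor`, every classical unit-viscosity `(u, p)` on `ℝ³ × (−1, 0)` with the parabolic (Landau)
tail `√(−t) u(t, √(−t) y) → U y` (`y ≠ 0`) satisfies, for every core ratio `ρ ∈ (0, 1]` and every window
`−1 ≤ s₁ < s₂ ≤ 0`,

  `liminf_{λ → 0⁺} λ⁻³ ∫_{λ²s₁}^{λ²s₂} ∫_{B_{λρ}} |u(t, x) − U(x)|² dx dt ≥ c ρ (s₂ − s₁)`:

at times `t ≈ −λ²` the parabolic core ball `B_{ρλ} ≈ B_{ρ√(−t)}` carries an `L²`-deviation from the FROZEN Landau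
flow `U(x)` of size `≳ ρλ` per unit scaled time, i.e. comparable to Landau's own mass `∫_{B_{ρλ}}|U|² ∼ ρλ` there —
uniformly in `ρ`: the core of a Landau-tailed singularity is never an `L²`-small perturbation of the Landau flow at
any sub-parabolic scale. Proof: the space–time substitution `(τ, y) ↦ (λ²τ, λy)` (Jacobian `λ⁵`) and the
homogeneity `U(λy) = λ⁻¹ U(y)` turn the physical integral into `λ³ ∫_{s₁}^{s₂}∫_{B_ρ} |nsRescale λ u − U|²`
(`landauTail_physical_defect_eq_nsRescale`), and `landauTail_defect_floor` applies.

References: Landau 1944; Lemarié-Rieusset 2016 (10.48); Caffarelli–Kohn–Nirenberg 1982 (parabolic scaling).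
-/

set_option linter.dupNamespace false

noncomputable section

open Filter Set Topology MeasureTheory Metric Function
open scoped ENNReal NNReal
open Literature.Analysis.FluidPDE

namespace Summit.NavierStokesRegularity.NavierStokesRegularity.Theorems

/-- **The physical defect is the rescaled defect** (parabolic change of variables): for `r > 0`, a
`(−1)`-homogeneous `U` and any `u`,
`r⁻³ ∫_{r²s₁}^{r²s₂} ∫_{B_{rρ}} |u − U|² = ∫_{s₁}^{s₂} ∫_{B_ρ} |nsRescale r u − U|²`
(`(τ, y) ↦ (r²τ, r y)` has Jacobian `r⁵`, and `u(r²τ, ry) − U(ry) = r⁻¹ (nsRescale r u (τ, y) − U y)`). [folklore] -/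
theorem landauTail_physical_defect_eq_nsRescale
    (u : ℝ → EuclideanSpace ℝ (Fin 3) → EuclideanSpace ℝ (Fin 3))
    {U : EuclideanSpace ℝ (Fin 3) → EuclideanSpace ℝ (Fin 3)}
    (hhom : ∀ c : ℝ, 0 < c → ∀ x, U (c • x) = c⁻¹ • U x) {r : ℝ} (hr : 0 < r) (ρ s₁ s₂ : ℝ) :
    ENNReal.ofReal (r⁻¹ ^ 3) * ∫⁻ z in Ioo (r ^ 2 * s₁) (r ^ 2 * s₂) ×ˢ ball (0 : EuclideanSpace ℝ (Fin 3)) (r * ρ),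
        ‖u z.1 z.2 - U z.2‖ₑ ^ 2 =
      ∫⁻ z in Ioo s₁ s₂ ×ˢ ball (0 : EuclideanSpace ℝ (Fin 3)) ρ, ‖nsRescale r u z.1 z.2 - U z.2‖ₑ ^ 2 := by
  set Sph : Set (ℝ × EuclideanSpace ℝ (Fin 3)) :=
    Ioo (r ^ 2 * s₁) (r ^ 2 * s₂) ×ˢ ball (0 : EuclideanSpace ℝ (Fin 3)) (r * ρ) with hSph
  set F : ℝ × EuclideanSpace ℝ (Fin 3) → ℝ≥0∞ := fun z => ‖u z.1 z.2 - U z.2‖ₑ ^ 2 with hF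
  have hr2 : 0 < r ^ 2 := pow_pos hr 2
  -- the preimage of the physical cylinder under `(τ, y) ↦ (r²τ, r y)`
  have hpre : stAffine (r ^ 2) r 0 (0 : EuclideanSpace ℝ (Fin 3)) ⁻¹' Sph =
      Ioo s₁ s₂ ×ˢ ball (0 : EuclideanSpace ℝ (Fin 3)) ρ := by
    ext ⟨τ, y⟩
    simp only [hSph, mem_preimage, stAffine_apply, zero_add, mem_prod, mem_Ioo, mem_ball, dist_zero_right,
      norm_smul, Real.norm_eq_abs, abs_of_pos hr]
    constructor
    · rintro ⟨⟨h1, h2⟩, h3⟩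
      exact ⟨⟨lt_of_mul_lt_mul_left h1 hr2.le, lt_of_mul_lt_mul_left h2 hr2.le⟩,
        lt_of_mul_lt_mul_left h3 hr.le⟩
    · rintro ⟨⟨h1, h2⟩, h3⟩
      exact ⟨⟨mul_lt_mul_of_pos_left h1 hr2, mul_lt_mul_of_pos_left h2 hr2⟩, mul_lt_mul_of_pos_left h3 hr⟩
  -- the integrand along the map
  have hcomp : ∀ z : ℝ × EuclideanSpace ℝ (Fin 3),
      F (stAffine (r ^ 2) r 0 (0 : EuclideanSpace ℝ (Fin 3)) z) =
        ENNReal.ofReal (r⁻¹ ^ 2) * ‖nsRescale r u z.1 z.2 - U z.2‖ₑ ^ 2 := by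
    rintro ⟨τ, y⟩
    simp only [hF, stAffine_apply, zero_add, nsRescale_apply]
    have e : u (r ^ 2 * τ) (r • y) - U (r • y) = r⁻¹ • (r • u (r ^ 2 * τ) (r • y) - U y) := by
      rw [hhom r hr y, smul_sub, smul_smul, inv_mul_cancel₀ hr.ne', one_smul]
    rw [e, enorm_smul, mul_pow, Real.enorm_eq_ofReal (inv_nonneg.2 hr.le), ENNReal.ofReal_pow (inv_nonneg.2 hr.le)]
  have key := setLIntegral_preimage_comp_stAffine hr2 hr 0 (0 : EuclideanSpace ℝ (Fin 3)) F Sph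
  rw [hpre, finrank_euclideanSpace_fin] at key
  simp_rw [hcomp] at key
  rw [lintegral_const_mul' _ _ ENNReal.ofReal_ne_top] at key
  -- `key : r⁻² · G = (r² r³)⁻¹ · I`; multiply by `r²`
  have hI : ENNReal.ofReal (r⁻¹ ^ 3) * ∫⁻ z in Sph, F z =
      ENNReal.ofReal (r ^ 2) * (ENNReal.ofReal (r ^ 2 * r ^ 3)⁻¹ * ∫⁻ z in Sph, F z) := by
    rw [← mul_assoc, ← ENNReal.ofReal_mul (by positivity)]
    congr 2
    field_simp
  rw [hI, ← key, ← mul_assoc, ← ENNReal.ofReal_mul (by positivity),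
    show r ^ 2 * r⁻¹ ^ 2 = 1 by field_simp, ENNReal.ofReal_one, one_mul]

/-- **The scaled `L²`-defect floor in physical variables** (registered support stub A8 of crux
stmt-NavierStokesRegularity-1944, lead c6): with `c = c(U) > 0` from `landauTail_defect_floor`, every classical
unit-viscosity `(u, p)` on `ℝ³ × (−1, 0)` with the tail `√(−t) u(t, √(−t) y) → U y` (`y ≠ 0`) satisfies
`liminf_{λ→0⁺} λ⁻³ ∫_{λ²s₁}^{λ²s₂}∫_{B_{λρ}} |u(t,x) − U(x)|² dx dt ≥ c ρ (s₂ − s₁)` for all `ρ ∈ (0,1]`,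
`−1 ≤ s₁ < s₂ ≤ 0` (Landau 1944; Lemarié-Rieusset 2016 (10.48); CKN 1982 scaling). -/
theorem landauTail_defect_floor_physical : ∀ (U : EuclideanSpace ℝ (Fin 3) → EuclideanSpace ℝ (Fin 3)) (P : EuclideanSpace ℝ (Fin 3) → ℝ), (ContDiffOn ℝ (⊤ : ℕ∞) U {0}ᶜ ∧ ContDiffOn ℝ (⊤ : ℕ∞) P {0}ᶜ ∧ (∀ x : EuclideanSpace ℝ (Fin 3), x ≠ 0 → Literature.Analysis.FluidPDE.convect U U x + gradient P x = (1 : ℝ) • Laplacian.laplacian U x) ∧ (∀ x : EuclideanSpace ℝ (Fin 3), x ≠ 0 → Literature.Analysis.FluidPDE.VectorCalculus.divergence U x = 0) ∧ (∀ c : ℝ, 0 < c → ∀ x : EuclideanSpace ℝ (Fin 3), U (c • x) = c⁻¹ • U x) ∧ (∃ x : EuclideanSpace ℝ (Fin 3), U x ≠ 0)) → ∃ c : ℝ, 0 < c ∧ ∀ (u : ℝ → EuclideanSpace ℝ (Fin 3) → EuclideanSpace ℝ (Fin 3)) (p : ℝ → EuclideanSpace ℝ (Fin 3) → ℝ), Literature.Analysis.FluidPDE.IsClassicalNSSolutionOn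 (Set.Ioo (-1) 0) 1 0 u p → (∀ y : EuclideanSpace ℝ (Fin 3), y ≠ 0 → Filter.Tendsto (fun t : ℝ => Real.sqrt (0 - t) • u t (Real.sqrt (0 - t) • y)) (nhdsWithin 0 (Set.Iio 0)) (nhds (U y))) → ∀ ρ : ℝ, 0 < ρ → ρ ≤ 1 → ∀ s₁ s₂ : ℝ, -1 ≤ s₁ → s₁ < s₂ → s₂ ≤ 0 → ENNReal.ofReal (c * ρ * (s₂ - s₁)) ≤ Filter.liminf (fun r : ℝ => ENNReal.ofReal (r⁻¹ ^ 3) * ∫⁻ z in Set.Ioo (r ^ 2 * s₁) (r ^ 2 * s₂) ×ˢ Metric.ball (0 : EuclideanSpace ℝ (Fin 3)) (r * ρ), ‖u z.1 z.2 - U z.2‖ₑ ^ 2) (nhdsWithin 0 (Set.Ioi 0)) := by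
  intro U P hprof
  obtain ⟨c, hc, hA7⟩ := landauTail_defect_floor U P hprof
  obtain ⟨-, -, -, -, hhom, -⟩ := hprof
  refine ⟨c, hc, ?_⟩
  intro u p hcl htail ρ hρ hρ1 s₁ s₂ hs₁ hs₁₂ hs₂
  have hcongr : (fun r : ℝ => ∫⁻ z in Ioo s₁ s₂ ×ˢ ball (0 : EuclideanSpace ℝ (Fin 3)) ρ,
      ‖nsRescale r u z.1 z.2 - U z.2‖ₑ ^ 2) =ᶠ[𝓝[>] (0 : ℝ)]
      fun r => ENNReal.ofReal (r⁻¹ ^ 3) * ∫⁻ z in Ioo (r ^ 2 * s₁) (r ^ 2 * s₂) ×ˢ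
        ball (0 : EuclideanSpace ℝ (Fin 3)) (r * ρ), ‖u z.1 z.2 - U z.2‖ₑ ^ 2 := by
    filter_upwards [self_mem_nhdsWithin] with r hr
    exact (landauTail_physical_defect_eq_nsRescale u hhom hr ρ s₁ s₂).symm
  rw [← liminf_congr hcongr]
  exact hA7 u p hcl htail ρ hρ hρ1 s₁ s₂ hs₁ hs₁₂ hs₂

end Summit.NavierStokesRegularity.NavierStokesRegularity.Theorems

end
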